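import Mathlib.LinearAlgebra.Matrix.Determinant.Basic
import Mathlib.LinearAlgebra.Matrix.Block
import Literature.Analysis.TotalPositivity.PolyaFrequency
import Literature.Analysis.TotalPositivity.PolyaFrequencyClosure
import Literature.Analysis.TotalPositivity.PolyaFrequencyDeflation
import HarnessLib

/-!
# Recognition of Pólya frequency sequences from initial-column minors (Ando–Cryer) and the
# pole-stripping step `b ↦ b - ℓ·Sb` in full PF

Trunk T-ANALYSIS (Literature/Analysis/TotalPositivity). Part 3 of the decomposition of the named
fact `Literature.Analysis.TotalPositivity.aswe_edrei` (PolyaFrequency.lean; Aissen–Edrei–Schoenberg–Whitney 1951,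
Thm. 4): the finite-dimensional linear-algebra input needed to run the Aissen–Schoenberg–Whitney
deflation ("remove the pole of smallest modulus", [AissenEdreiSchoenbergWhitney1951, Thm. 2] =
Aissen–Schoenberg–Whitney 1952, where "Whitney's reduction theorem for totally positive matrices
was a key component" [FallatJohnson2011, p. 28]) inside the class of PÓLYA FREQUENCY sequences
rather than in the weaker class `IsColumnPF` of `PolyaFrequencyDeflation.lean`.

* `ando1987_lowerTriangular_tn` — NAMED FACT (**Ando 1987, Cor. 2.2** = Cryer 1976;
  Fallat–Johnson 2011, Lemma 3.3.4): an invertible lower triangular real matrix all of whose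
  minors with INITIAL columns `1, …, k` (and arbitrary rows) are `≥ 0` is totally nonnegative.
  (Ando derives it from his Thm. 2.1 — a rank-`r` matrix is sign-regular as soon as its minors
  with column dispersion `≤ m - r` have the prescribed signs — whose printed proof is an
  induction using Sylvester's identity and the generalised Karlin identity; not reproduced here.)
* `IsColumnPF.isPolyaFrequencySeq_of_ando` — consequently a column-positive one-sided sequence
  (`IsColumnPF`: all Toeplitz minors with consecutive columns `≥ 0`) with `b₀ > 0` is a Pólya
  frequency sequence: every Toeplitz minor lives in a truncation `T_N(b) = (b_{i-j})_{i,j<N}`,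
  which is lower triangular with determinant `b₀^N > 0`, and whose initial-column minors are
  consecutive-column Toeplitz minors.
* `IsPolyaFrequencySeq.mulLinear_neg_of_ando` — **pole stripping in PF**: if `b` is PF with all
  `bₙ > 0` and `ℓ = lim b_{n+1}/bₙ` (`ratioLimit b`), then `(bₙ - ℓ b_{n-1})ₙ`, the coefficient
  sequence of `(1 - ℓz) Σ bₙ zⁿ`, is again PF — the tree's virtual-row theorem
  `IsColumnPF.mulLinear_neg` gives column positivity, and `b₀ - ℓ·0 = b₀ > 0`.

## References

* T. Ando, *Totally positive matrices*, Linear Algebra Appl. 90 (1987) 165–219, Thm. 2.1 and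
  Cor. 2.2 (p. 181). [Ando1987]
* C. W. Cryer, *Some properties of totally positive matrices*, Linear Algebra Appl. 15 (1976)
  1–25, Thm. 1.3.
* S. M. Fallat, C. R. Johnson, *Totally Nonnegative Matrices*, Princeton UP 2011, Thm. 3.3.2 and
  Lemma 3.3.4 (recognition), Thm. 2.2.1 (Whitney's reduction), p. 28. [FallatJohnson2011]
* M. Aissen, A. Edrei, I. J. Schoenberg, A. Whitney, Proc. Nat. Acad. Sci. USA 37 (1951)
  303–307, Thm. 2. [AissenEdreiSchoenbergWhitney1951]
-/

noncomputable section

open Finset Matrix Filter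
open scoped Topology

namespace Literature.Analysis.TotalPositivity

/-! ### The recognition theorem (named fact) -/

/-- NAMED FACT (**Ando 1987, Cor. 2.2**; = Cryer 1976, and Fallat–Johnson 2011, Lemma 3.3.4):
"An `n`-square invertible lower triangular matrix `A` is totally positive [i.e. all minors are
`≥ 0`, Ando's terminology] if `det A[α | 1, 2, …, k] ≥ 0` for every `k` and `α ∈ Q_{k,n}`."
Here: `A : Matrix (Fin n) (Fin n) ℝ` with `A i j = 0` for `i < j` and `det A ≠ 0`; the hypothesis
is over strictly increasing row selections `r : Fin k → Fin n` with the initial columns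
`Fin.castLE : Fin k → Fin n`; the conclusion is over all strictly increasing `r, c`. Users take
`(h : ando1987_lowerTriangular_tn)`. [cite: Ando1987, Cor. 2.2] -/
def ando1987_lowerTriangular_tn : Prop :=
  ∀ (n : ℕ) (A : Matrix (Fin n) (Fin n) ℝ),
    (∀ i j : Fin n, i < j → A i j = 0) → A.det ≠ 0 →
    (∀ (k : ℕ) (hk : k ≤ n) (r : Fin k → Fin n), StrictMono r →
      0 ≤ (A.submatrix r (Fin.castLE hk)).det) →
    ∀ (k : ℕ) (r c : Fin k → Fin n), StrictMono r → StrictMono c → 0 ≤ (A.submatrix r c).det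

/-- The case `k = 0` of the conclusion is automatic (empty determinant), a sanity check on the
packaging. [folklore] -/
theorem ando1987_lowerTriangular_tn.case_zero {n : ℕ} (A : Matrix (Fin n) (Fin n) ℝ)
    (r c : Fin 0 → Fin n) : 0 ≤ (A.submatrix r c).det := by
  simp [Matrix.det_isEmpty]

/-! ### Column positivity + `b₀ > 0` ⇒ PF -/

/-- The truncated Toeplitz matrix `(b_{i-j})_{i,j<N}` of a one-sided sequence. [folklore] -/
theorem det_toeplitzTrunc (b : ℕ → ℝ) (N : ℕ) :
    (Matrix.of fun i j : Fin N => seqZ b ((i : ℕ) - (j : ℕ) : ℤ)).det = b 0 ^ N := by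
  rw [Matrix.det_of_lowerTriangular]
  · simp [seqZ]
  · intro i j hij
    simp only [Matrix.of_apply]
    exact seqZ_of_neg b (by have : (i : ℕ) < j := hij; omega)

/-- **Recognition for sequences.** A column-positive one-sided sequence with `b₀ > 0` is a Pólya
frequency sequence, granted Ando's Cor. 2.2: the Toeplitz minor with rows `r` and columns `c` is a
minor of the truncation `T_N(b)`, `N > max(rᵢ, cᵢ)`, which is lower triangular with
`det = b₀^N ≠ 0` and whose initial-column minors are the consecutive-column minors of `b` at
`j = 0`. [Ando 1987, Cor. 2.2; Fallat–Johnson 2011, Lemma 3.3.4] [folklore] -/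
theorem IsColumnPF.isPolyaFrequencySeq_of_ando (hA : ando1987_lowerTriangular_tn) {b : ℕ → ℝ}
    (hb : IsColumnPF b) (h0 : 0 < b 0) : IsPolyaFrequencySeq b := by
  intro p r c hr hc
  -- ambient size
  set N : ℕ := Finset.univ.sup r + Finset.univ.sup c + 1 with hN
  have hrN : ∀ i, r i < N := fun i => by
    have : r i ≤ Finset.univ.sup r := Finset.le_sup (Finset.mem_univ i)
    omega
  have hcN : ∀ i, c i < N := fun i => by
    have : c i ≤ Finset.univ.sup c := Finset.le_sup (Finset.mem_univ i)
    omega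
  set A : Matrix (Fin N) (Fin N) ℝ := Matrix.of fun i j : Fin N => seqZ b ((i : ℕ) - (j : ℕ) : ℤ)
    with hAdef
  have hlt : ∀ i j : Fin N, i < j → A i j = 0 := fun i j hij => by
    simp only [hAdef, Matrix.of_apply]
    exact seqZ_of_neg b (by have : (i : ℕ) < j := hij; omega)
  have hdet : A.det ≠ 0 := by
    rw [hAdef, det_toeplitzTrunc]
    exact pow_ne_zero _ h0.ne'
  have hinit : ∀ (k : ℕ) (hk : k ≤ N) (r' : Fin k → Fin N), StrictMono r' →
      0 ≤ (A.submatrix r' (Fin.castLE hk)).det := by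
    intro k hk r' hr'
    have h := hb k (fun i => (r' i : ℕ)) 0 (fun i j hij => hr' hij)
    unfold toeplitzMinor at h
    convert h using 2
    ext i j
    simp [hAdef]
  set R : Fin p → Fin N := fun i => ⟨r i, hrN i⟩ with hR
  set C : Fin p → Fin N := fun i => ⟨c i, hcN i⟩ with hC
  have h := hA N A hlt hdet hinit p R C (fun i j hij => show r i < r j from hr hij)
    (fun i j hij => show c i < c j from hc hij)
  unfold toeplitzMinor
  convert h using 2
  ext i j
  simp [hAdef, hR, hC]

/-! ### Pole stripping in PF -/

/-- **Pole stripping preserves PF** (granted Ando's Cor. 2.2). If `b` is a Pólya frequency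
sequence with all `bₙ > 0` and `ℓ = lim b_{n+1}/bₙ` (`ratioLimit b`, the reciprocal of the radius
of convergence of `Σ bₙ zⁿ`), then the coefficient sequence `(bₙ - ℓ b_{n-1})ₙ` of
`(1 - ℓz) Σ bₙ zⁿ` is again a Pólya frequency sequence: column-positive by the virtual-row
theorem `IsColumnPF.mulLinear_neg`, with zeroth term `b₀ > 0`. This is the step "divide out the
pole of smallest modulus" of the Aissen–Schoenberg–Whitney deflation.
[Aissen–Edrei–Schoenberg–Whitney 1951, Thm. 2 (via Whitney's reduction theorem, Fallat–Johnson
2011, p. 28)] [folklore] -/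
theorem IsPolyaFrequencySeq.mulLinear_neg_of_ando (hA : ando1987_lowerTriangular_tn) {b : ℕ → ℝ}
    (hb : IsPolyaFrequencySeq b) (hpos : ∀ n, 0 < b n) :
    IsPolyaFrequencySeq (Literature.Analysis.TotalPositivity.mulLinear b (-(ratioLimit b))) := by
  have hcol : IsColumnPF (Literature.Analysis.TotalPositivity.mulLinear b (-(ratioLimit b))) :=
    hb.isColumnPF.mulLinear_neg hpos (hb.isColumnPF.tendsto_ratio_pow hpos)
  exact hcol.isPolyaFrequencySeq_of_ando hA (by simpa using hpos 0)

end Literature.Analysis.TotalPositivity
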